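import Literature.MathematicalPhysics.QuantumFieldTheory.BalabanImbrieJaffe1984to88.BIJ88Eq5145Corner
import Literature.MathematicalPhysics.QuantumFieldTheory.BalabanImbrieJaffe1984to88.BIJ88SlotConnectedGraph310

/-!
# `BalabanImbrieJaffe1984to88.BIJ88Eq5145CornerModel` — T. Bałaban, J. Imbrie, A. Jaffe, *Effective action and cluster properties of the
abelian Higgs model*, Commun. Math. Phys. **114** (1988) 257–315 [BalabanImbrieJaffe1988]: Sect. 5.14, p. 312 [PDF 56], **(5.14.5) ON THE
§5.13 GAUSSIAN MODEL WITH THE p. 308 CUBE FACTORS — `z`, `z_F/z` CONCRETE, `z > 0` DISCHARGED** (rows `C2.Eq5.14.5`, `C2.Eq5.14.1-5.14.2`).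
Gen 13's `BIJ88Eq5145Corner.eq5145_corner_gauss` assembled (5.14.5) in the admissible bookkeeping of (5.13.4)/(5.14.1) on the Gaussian measures
of §5.13 for ANY cube-local factors `f`, carrying per region `Λ₁₂` the displayed inputs `hz` (`z > 0`), `hratio` (*"z_F = (z_F/z)·z"*), `hlogz`
((5.14.2)), `hrem` (p. 310), `h311` (p. 311). Here the factors ARE the print's: `f(□_i) = u_i · F_i` with `u_i` = the product over the slots
located in `□_i` of the p. 308 slot factors at `t = 1` (small-field characteristic functions `χ(c_b p(e_k), Φ_b)` and Boltzmann factors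
`e^{−V(Y)}` — p36's `fD (uD χ p e_k B Φ c Ys V 1) cube γ ∅`) and `F_i` a cube-local observable; then `z(Λ₁₂)` and `z_F/z` are CONCRETE
(`z(Λ₁₂) := ⟨Π_{i∈Λ₁₂} u_i⟩_{1_{Λ₁₂′},Λ₁₂}`, `z_F/z := ⟨Π u_i F_i⟩/⟨Π u_i⟩`), `hratio` holds BY DEFINITION and `hz` is PROVED (the law of the fields
charges the small-field box around `φ = 0` — p36's small-ball argument, transported to the corner `1_{Λ₁₂′}` by the reparametrization
`⟨·⟩_{1_Λ,X} = ⟨·⟩_{1_X,X}` for the form `Δ_{1_Λ}`), so that (5.14.5) holds with ONLY `hlogz` (−log z = 𝒫̃ + ℛ, the `t = 0` end of (5.14.2)),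
`hrem` and `h311` displayed, and `z(Λ₁₂)` IS the `z_t` (at `t = 1`) of p36's p. 308 family of the slots located in `Λ₁₂` under the law of
the region — the object of p36 g11's `t = 0` theorem `effectiveAction_eq_pertP_add_remR_ursell`, consumed by name in the sequel
`BIJ88Eq5145CornerUrsell`.

HONEST FRAMING (cell `lit-balaban`, verbatim): statement-level skeleton of published theorems with citation tags; proofs where landed; nothing here is a claim about the Yang–Mills mass gap.

PDF held: `paper:balaban1988-cmp114-bij-abelian-higgs-effective-action` (journal page = PDF page + 256); pp. 306, 308–312 = PDF 50, 52–56, read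
this session.

**(5.14.5)** p. 312 [PDF 56], verbatim: *"To summarize the results of this section, we have e^{−V^{(k)}_{const}(Λ₈^{(k)})} Σ_{{X_α}} Π_α g₂(X_α) =
Σ_{{X_α} overlapping Λ₁₁^{(k)c}} Π_α g₂(X_α) Σ_{{X_{r′}}} Π_{r′} G_k(X_{r′}) × Π_{c} F^L_{k+1,loc}(X_c) exp(−𝒫^L_{k+1,loc}(Λ₈^{(k)}) − Σ_X W₆^{(k)}(X)).
(5.14.5)"*; (5.14.1) p. 308: *"Σ_{{X_α}} Π_α g₂(X_α) = Σ_{{X_α} overlapping Λ₁₁^{(k)c}} Π_α g₂(X_α) z_F(Λ₁₂^{(k)}). (5.14.1) We now write z_F =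
(z_F/z) exp(log z), where z(Λ₁₂^{(k)}) = z_{F=1}(Λ₁₂^{(k)}), and apply (5.14.2)"*; (5.14.2) p. 308: *"z_t(Λ₁₂^{(k)}) = ⟨χ′_{Λ₁₂^{(k)},t}
e^{−tṼ^{(k)}(Λ₁₂^{(k)})}⟩₁, where χ′_{Λ,t} = Π_{Φ^{(j)}_k, j<k} χ_{Λ^{(j)}∩Λ}(…) … −log z₁(Λ₁₂^{(k)}) = 𝒫̃_{k+1}(Λ₁₂^{(k)}) + ℛ_k(Λ₁₂^{(k)})"*;
p. 306: *"⟨·⟩_{s_Γ,X} is defined by integrating over the fields in X only"*; p. 304: *"f(□_i) is the product of all the factors … localized in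
□_i"*; p. 312: *"z_F/z = ⟨Π_{σ₁} F^{m̄}_{k,loc}(X_{σ₁})⟩₁"*.

**What is proved (0 `sorry`, standard axioms, 0 new `Prop` facts; 4 notational `abbrev`s).** §0 NOTATION: `regionLaw X Λ` (the law of the
fields of `X` at the corner `1_Λ` = p36's `fieldLaw` of `X` for `Δ_{1_Λ}`), `slotB`, `slotY` (the χ-slots and the interaction slots located in `X`;
`mem_slotB`/`mem_slotY`), `ztIn X Λ t` (p36's `zt` of the located slots under `regionLaw X Λ`). §1 THE CORNER REPARAMETRIZATION: the `X`-marginal precision at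
the corner `1_Λ` is the self-corner precision of the resummed form `Δ_{1_Λ}` (`prec_interp_corner`), hence `⟨·⟩_{1_Λ,X} = ⟨·⟩_{1_X,X}[Δ_{1_Λ}]`
(`expect_interp_corner`, `zG_eq_zG_interp`), `z X Λ = ∫ Π_{i∈X} f_i d(law of the fields of X for Δ_{1_Λ})` (`zG_eq_integral_regionLaw`),
positive definiteness (`prec_corner_posDef`, `prec_interp_corner_posDef`, `isProbabilityMeasure_regionLaw`). §2 OBSERVABLES: `Π(u·F) = Πu · ΠF` (`obs_mul`) and
**`zG_mul_eq_ratio_mul`** — *"z_F = (z_F/z)·z"* with `z_F/z = ⟨Π_{i∈X} F_i⟩₁ := ∫ ΠF·Πu dlaw / ∫ Πu dlaw`, the expectation in the normalized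
interacting measure. §3 THE p. 308 CUBE FACTORS OVER A REGION: `Π_{i∈X} u_i = Π_{slots τ located in X} slotFactor_τ(t)` (`obs_fD_empty_eq_prod_filter`,
no "all slots in X" hypothesis) `= (Π_{b: □(b)⊂X} χ(c_b p(te_k), Φ_b)) · e^{−tΣ_{Y⊂X}V(Y)}` (`prod_filter_slotFactor`), so `z(X)(Λ)` is the
restricted interacting integral (`zG_fD_empty_eq_integral`) = THE `z_t` OF THE p. 308 FAMILY of the slots located in `X` under the law of the
fields of `X` at the corner `1_Λ` (**`zG_fD_empty_eq_ztIn`**), and **`zG_fD_empty_pos`**: `z_t(X)(Λ) > 0` for `χ ≥ 0`, `p ≥ 0`, `Δ ≻ 0`,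
continuous `Φ_b` with `Φ_b(0) = 0`, `c_b ≥ c₀ > 0`, measurable bounded `V_Y`, `0 < t`, `te_k ≤ e^{−1}` (p36's `fieldLaw_real_pos_of_isOpen` +
gen 8's `integral_restrictedInteraction_pos_of_smallBall`). §4 **`eq5145_zG`** — (5.14.5) for `f = u·F`: left side
`e^{−V_const}·⟨Π_{i∈W} u_i F_i⟩_{1,W}`, right side `Σ_{ρ admissible outer} (Π_{X∈ρ} g₁ X) · (z_F/z)(Λ₁₂) · exp(−𝒫^L − Σ_X (W₆′ + W₆″))` with
`z`, `z_F/z` the concrete corner expectations, hypotheses per region ONLY `hlogz : −log z(Λ₁₂)(Λ₁₂′) = pert + rem`, `hrem`, `h311`;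
**`eq5145_zG_extraction`** — `h311` by name (p31's `extraction311`). The sequel `BIJ88Eq5145CornerUrsell` takes `hlogz` BY NAME from
p36 g11's `effectiveAction_eq_pertP_add_remR_ursell` applied to the `z_t` of §3.
HONEST SCOPE: observables are cube-local factors `F_i` (gen 8's reading of (5.13.4): the Mayer data `g₂ ↔ g₁`; print's `F^{m̄}_{k,loc}(X_{σ₁})`
live on located regions); the IBP structure of `z_F/z` (p. 312, print's *"Without going into details"*) is `BIJ88IbpResult312`/
`BIJ88ObservableExtraction312` and is not re-derived on the model; `ℛ = Σ W₆′` (display 4 of p. 310 with the cumulants = p25's `Tsum` modulo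
the leaf (5.14.4): p36's `ursell_slotMoment_fieldLaw_eq_Tsum_of_ineq5144`, p25's `remR_eq_sum_W6'`) stays displayed per region; the located
imprecision of (5.14.1) (inner factor `z(Λ₁₂)(Λ₁₂′)`) is carried verbatim. Imports `BIJ88Eq5145Corner` (p25 g13), `BIJ88SlotConnectedGraph310`
(p36 g10); modifies nothing. NOT summit progress; NOT continuum; NOT Clay. Cell `lit-balaban` Phase 2, seat p25 gen 13 (row owner r16, referee ref-5).
-/

noncomputable section

open Finset MeasureTheory ProbabilityTheory
open Literature.MathematicalPhysics.QuantumFieldTheory.BalabanImbrieJaffe1984to88.BIJ88DirichletForms305 (interpForm interpForm_apply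
  interpForm_posDef)
open Literature.MathematicalPhysics.QuantumFieldTheory.BalabanImbrieJaffe1984to88.BIJ88Clusters5134 (IsClusterFactorizing)
open Literature.MathematicalPhysics.QuantumFieldTheory.BalabanImbrieJaffe1984to88.BIJ88PolymerRep5134 (g1 IsAdmissible corner corner_apply)
open Literature.MathematicalPhysics.QuantumFieldTheory.BalabanImbrieJaffe1984to88.BIJ88PolymerRep5134Gauss (ext obs prec src expect zG
  isClusterFactorizing_zG)
open Literature.MathematicalPhysics.QuantumFieldTheory.BalabanImbrieJaffe1984to88.BIJ88Resummation5141 (outer lam12 lam12_subset)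
open Literature.MathematicalPhysics.QuantumFieldTheory.BalabanImbrieJaffe1984to88.BIJ88Resummation5141Adm (lam12')
open Literature.MathematicalPhysics.QuantumFieldTheory.BalabanImbrieJaffe1984to88.BIJ88Expansion5143Gauss (fD fD_local)
open Literature.MathematicalPhysics.QuantumFieldTheory.BalabanImbrieJaffe1984to88.BIJ88SlotMoments308 (slotFactor slotFactor_inl
  slotFactor_inr zt zt_eq)
open Literature.MathematicalPhysics.QuantumFieldTheory.BalabanImbrieJaffe1984to88.BIJ88SlotMomentsGauss308 (fieldLaw uD
  expect_corner_eq_integral isProbabilityMeasure_fieldLaw fieldLaw_real_pos_of_isOpen continuous_ext ext_zero measurable_ext)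
open Literature.MathematicalPhysics.QuantumFieldTheory.BalabanImbrieJaffe1984to88.BIJ88SlotConnectedGraph310 (uD_local)
open Literature.MathematicalPhysics.QuantumFieldTheory.BalabanImbrieJaffe1984to88.BIJ88Extraction311 (pert PL W6pp extraction311)
open Literature.MathematicalPhysics.QuantumFieldTheory.BalabanImbrieJaffe1984to88.BIJ88Eq5145Corner (eq5145_corner_gauss)
open Literature.MathematicalPhysics.QuantumFieldTheory.BalabanImbrieJaffe1984to88.BIJ88Sect2Statements (pLog)
open Literature.MathematicalPhysics.QuantumFieldTheory.BalabanImbrieJaffe1984to88.BIJ88Sect5Statements (CutoffProfile cutoff)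

namespace Literature.MathematicalPhysics.QuantumFieldTheory.BalabanImbrieJaffe1984to88.BIJ88Eq5145CornerModel

variable {α I : Type} [Fintype α] [DecidableEq α] [Fintype I] [DecidableEq I]
  (blk : α → I) (Δ : Matrix α α ℝ) (ℱ : α → ℝ) (f : I → (α → ℝ) → ℝ)

/-! ## §0 The law of the fields of a region at a corner; the slots located in a region; the region's `z_t` -/

/-- **the law of the fields of the region `X` at the corner `1_Λ`** — the probability measure of `⟨·⟩_{1_Λ,X}` (p. 306: *"⟨·⟩_{s_Γ,X} is
defined by integrating over the fields in X only"*): p36's `fieldLaw` of the region `X` for the resummed form `Δ_{1_Λ}` (§1 below: the same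
Gaussian). [cite: BalabanImbrieJaffe1988, p.306 (Sect. 5.13); (5.14.3) p.309] -/
abbrev regionLaw (X Λ : Finset I) : Measure ({x : α // blk x ∈ X} → ℝ) := fieldLaw blk (interpForm blk Δ (corner ℝ Λ)) ℱ X

section Slots

variable {ι υ : Type*} (B : Finset ι) (Ys : Finset υ) (cube : ↥B ⊕ ↥Ys → I)

/-- the χ-slots (fields `Φ_b`) located in the region `X` (p. 308: *"χ′_{Λ,t} = Π_{Φ_k^{(j)}, j<k} χ_{Λ^{(j)}∩Λ}(…)"* — the characteristic
functions of the cubes of `Λ`). [cite: BalabanImbrieJaffe1988, (5.14.2) p.308] -/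
abbrev slotB (X : Finset I) : Finset ↥B := univ.filter fun b : ↥B => cube (Sum.inl b) ∈ X

/-- the interaction slots (terms `V(Y)`) located in the region `X` (p. 308: *"Ṽ^{(k)}(Λ₁₂^{(k)})"* — the terms of the region).
[cite: BalabanImbrieJaffe1988, (5.14.2) p.308] -/
abbrev slotY (X : Finset I) : Finset ↥Ys := univ.filter fun Y : ↥Ys => cube (Sum.inr Y) ∈ X

omit [Fintype I] in
/-- membership in the located χ-slots. [cite: BalabanImbrieJaffe1988, (5.14.2) p.308] -/
@[simp] theorem mem_slotB (X : Finset I) (b : ↥B) : b ∈ slotB B Ys cube X ↔ cube (Sum.inl b) ∈ X := by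
  simp [slotB]

omit [Fintype I] in
/-- membership in the located interaction slots. [cite: BalabanImbrieJaffe1988, (5.14.2) p.308] -/
@[simp] theorem mem_slotY (X : Finset I) (Y : ↥Ys) : Y ∈ slotY B Ys cube X ↔ cube (Sum.inr Y) ∈ X := by
  simp [slotY]

end Slots

section Zt

variable (χ : CutoffProfile) {ι υ : Type*} [DecidableEq ι] [DecidableEq υ]
variable (p ek : ℝ) (B : Finset ι) (Φ : ι → (α → ℝ) → ℝ) (c : ι → ℝ) (Ys : Finset υ) (V : υ → (α → ℝ) → ℝ)
variable (cube : ↥B ⊕ ↥Ys → I)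

/-- **the `z_t` of the region `X` at the corner `1_Λ`**: p36's `zt` ((5.14.2): `z_t(Λ₁₂) = ⟨χ′_{Λ₁₂,t} e^{−tṼ(Λ₁₂)}⟩₁`) of the p. 308 family of
the slots LOCATED IN `X` (fields and terms read through the extension map), under the law of the fields of `X` at the corner `1_Λ`.
[cite: BalabanImbrieJaffe1988, (5.14.2) p.308; p.306 (Sect. 5.13)] -/
abbrev ztIn (X Λ : Finset I) (t : ℝ) : ℝ :=
  zt χ p ek (slotB B Ys cube X) (fun b ω => Φ b (ext blk X ω)) (fun b => c b) (slotY B Ys cube X)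
    (fun Y ω => V Y (ext blk X ω)) (regionLaw blk Δ ℱ X Λ) t

end Zt

/-! ## §1 The corner reparametrization `⟨·⟩_{1_Λ,X} = ⟨·⟩_{1_X,X}[Δ_{1_Λ}]` -/

/-- **the `X`-marginal precision at the corner `1_Λ` is the self-corner precision of the resummed form `Δ_{1_Λ}`** (p. 305: *"□Δ_s□′ =
s_□ s_□′ □Δ□′"* — inside `X` the weights of `1_X` are all `1`). [cite: BalabanImbrieJaffe1988, p.305–306 (Sect. 5.13)] -/
theorem prec_interp_corner (X Λ : Finset I) :
    prec blk (interpForm blk Δ (corner ℝ Λ)) X (corner ℝ X) = prec blk Δ X (corner ℝ Λ) := by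
  ext x y
  have hx : corner ℝ X (blk x.1) = 1 := by rw [corner_apply, if_pos x.2]
  have hy : corner ℝ X (blk y.1) = 1 := by rw [corner_apply, if_pos y.2]
  by_cases hxy : blk x.1 = blk y.1
  · simp only [prec, Matrix.submatrix_apply, interpForm_apply, hxy, if_true]
  · simp only [prec, Matrix.submatrix_apply, interpForm_apply, hxy, if_false, hx, hy, one_mul]

/-- **`⟨·⟩_{1_Λ,X} = ⟨·⟩_{1_X,X}` for the form `Δ_{1_Λ}`** (same Gaussian density on the fields of `X`).
[cite: BalabanImbrieJaffe1988, p.306 (Sect. 5.13)] -/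
theorem expect_interp_corner (X Λ : Finset I) :
    expect blk (interpForm blk Δ (corner ℝ Λ)) ℱ f X (corner ℝ X) = expect blk Δ ℱ f X (corner ℝ Λ) := by
  simp only [BIJ88PolymerRep5134Gauss.expect, prec_interp_corner]

/-- **`z X Λ = z[Δ_{1_Λ}] X X`**: every corner expectation of (5.13.4) is a self-corner expectation of a resummed form — the shape in which
p36's lineage states the p. 308 family (`zG … W W`). [cite: BalabanImbrieJaffe1988, p.306 (Sect. 5.13); (5.14.1) p.308] -/
theorem zG_eq_zG_interp (X Λ : Finset I) : zG blk Δ ℱ f X Λ = zG blk (interpForm blk Δ (corner ℝ Λ)) ℱ f X X := by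
  simp only [zG, expect_interp_corner]

/-- **`z X Λ = ∫ Π_{i∈X} f(□_i) d(law of the fields of X at 1_Λ)`**. [cite: BalabanImbrieJaffe1988, p.306 (Sect. 5.13); (5.14.3) p.309] -/
theorem zG_eq_integral_regionLaw (X Λ : Finset I) :
    zG blk Δ ℱ f X Λ = ∫ φ, obs blk f X φ ∂(regionLaw blk Δ ℱ X Λ) := by
  rw [zG_eq_zG_interp, zG, expect_corner_eq_integral]

/-- the `X`-marginal precision at a corner is positive definite for `Δ ≻ 0` (principal block of `Δ_{1_Λ} ≻ 0`, p02's `interpForm_posDef` —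
*"To preserve positivity"*, p. 305). [cite: BalabanImbrieJaffe1988, p.305 (Sect. 5.13)] -/
theorem prec_corner_posDef (hΔ : Δ.PosDef) (X Λ : Finset I) : (prec blk Δ X (corner ℝ Λ)).PosDef :=
  (interpForm_posDef blk hΔ (s := corner ℝ Λ) fun i => by
    rw [corner_apply]; split_ifs <;> norm_num).submatrix Subtype.val_injective

/-- … and so is the self-corner precision of the resummed form (the hypothesis `hPD` of p36's lineage, for the region `X` and `Δ_{1_Λ}`).
[cite: BalabanImbrieJaffe1988, p.305 (Sect. 5.13)] -/
theorem prec_interp_corner_posDef (hΔ : Δ.PosDef) (X Λ : Finset I) :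
    (prec blk (interpForm blk Δ (corner ℝ Λ)) X (corner ℝ X)).PosDef := by
  rw [prec_interp_corner]; exact prec_corner_posDef blk Δ hΔ X Λ

/-- the law of the fields of a region at a corner is a probability measure (`Δ ≻ 0`). [cite: BalabanImbrieJaffe1988, (5.14.3) p.309] -/
theorem isProbabilityMeasure_regionLaw (hΔ : Δ.PosDef) (X Λ : Finset I) : IsProbabilityMeasure (regionLaw blk Δ ℱ X Λ) :=
  isProbabilityMeasure_fieldLaw blk _ ℱ X (prec_interp_corner_posDef blk Δ hΔ X Λ)

/-! ## §2 Observables: `f(□_i) = u_i · F_i`, *"z_F = (z_F/z)·z"* with `z_F/z = ⟨Π F⟩₁` -/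

section Observables

variable (u F : I → (α → ℝ) → ℝ)

omit [Fintype α] [DecidableEq α] [Fintype I] in
/-- `Π_{i∈X} (u_i F_i) = (Π_{i∈X} u_i)(Π_{i∈X} F_i)`. [cite: BalabanImbrieJaffe1988, (5.14.1) p.308] -/
theorem obs_mul (X : Finset I) (φ : {x : α // blk x ∈ X} → ℝ) :
    obs blk (fun i ψ => u i ψ * F i ψ) X φ = obs blk u X φ * obs blk F X φ := by
  simp only [obs]
  exact prod_mul_distrib

/-- **"z_F = (z_F/z) · z"** (p. 308) with **`z_F/z = ⟨Π_{i∈X} F_i⟩₁`** (p. 312 *"z_F/z = ⟨Π_{σ₁} F^{m̄}_{k,loc}(X_{σ₁})⟩₁"*; (5.14.3) *"⟨·⟩_t =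
(1/z_t)⟨· χ′ e^{−tṼ}⟩₁"*): the expectation of `Π F` in the normalized interacting measure `(Πu)·dlaw / ∫ Πu dlaw` of the region, for
`z ≠ 0`. [cite: BalabanImbrieJaffe1988, (5.14.1) p.308; (5.14.5) p.312] -/
theorem zG_mul_eq_ratio_mul (X Λ : Finset I) (hz : zG blk Δ ℱ u X Λ ≠ 0) :
    zG blk Δ ℱ (fun i ψ => u i ψ * F i ψ) X Λ =
      ((∫ φ, obs blk F X φ * obs blk u X φ ∂(regionLaw blk Δ ℱ X Λ)) / ∫ φ, obs blk u X φ ∂(regionLaw blk Δ ℱ X Λ)) *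
        zG blk Δ ℱ u X Λ := by
  rw [zG_eq_integral_regionLaw blk Δ ℱ u] at hz ⊢
  rw [div_mul_cancel₀ _ hz, zG_eq_integral_regionLaw]
  refine integral_congr_ae (Filter.Eventually.of_forall fun φ => ?_)
  rw [obs_mul]
  exact mul_comm _ _

/-- **`z_F/z`, the ratio of the two corner expectations, IS `⟨Π F⟩₁`** (the reading of the ratio in `eq5145_zG` below).
[cite: BalabanImbrieJaffe1988, (5.14.5) p.312] -/
theorem zG_div_zG_eq_ratio (X Λ : Finset I) (hz : zG blk Δ ℱ u X Λ ≠ 0) :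
    zG blk Δ ℱ (fun i ψ => u i ψ * F i ψ) X Λ / zG blk Δ ℱ u X Λ =
      (∫ φ, obs blk F X φ * obs blk u X φ ∂(regionLaw blk Δ ℱ X Λ)) / ∫ φ, obs blk u X φ ∂(regionLaw blk Δ ℱ X Λ) := by
  rw [div_eq_iff hz, zG_mul_eq_ratio_mul blk Δ ℱ u F X Λ hz]

end Observables

/-! ## §3 The p. 308 cube factors over a region: `z(X)(Λ)` is the `z_t` of the slots located in `X`; positivity -/

section CubeFactors

variable (χ : CutoffProfile) {ι υ : Type*} [DecidableEq ι] [DecidableEq υ]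
variable (p ek : ℝ) (B : Finset ι) (Φ : ι → (α → ℝ) → ℝ) (c : ι → ℝ) (Ys : Finset υ) (V : υ → (α → ℝ) → ℝ)
variable (cube : ↥B ⊕ ↥Ys → I) {L : Type*} (γ : L → ↥B ⊕ ↥Ys)

omit [Fintype α] [DecidableEq α] [Fintype I] in
/-- **over a region `X`, `Π_{i∈X} u_i = Π_{slots τ with □(τ) ⊂ X} slotFactor_τ(t)`** — the undifferentiated cube factors of p36's
`fD (uD … t) cube γ ∅` regrouped by slot; NO hypothesis that all slots lie in `X` (the slots outside `X` simply do not occur).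
[cite: BalabanImbrieJaffe1988, (5.14.2)–(5.14.3) pp.308–309] -/
theorem obs_fD_empty_eq_prod_filter (t : ℝ) (X : Finset I) (ω : {x : α // blk x ∈ X} → ℝ) :
    obs blk (fD (uD χ p ek B Φ c Ys V t) cube γ ∅) X ω =
      ∏ τ ∈ univ.filter (fun τ => cube τ ∈ X), slotFactor χ p ek B Φ c Ys V (ext blk X ω) τ t := by
  simp only [obs, fD, uD, filter_empty, card_empty, iteratedDeriv_zero]
  exact prod_fiberwise_eq_prod_filter _ _ _ _

omit [Fintype α] [DecidableEq α] [Fintype I] [DecidableEq ι] [DecidableEq υ] in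
/-- **`Π_{□(τ)⊂X} slotFactor_τ(t) = (Π_{b: □(b)⊂X} χ(c_b p(te_k), Φ_b)) · e^{−t Σ_{Y: □(Y)⊂X} V(Y)}`** — the p. 308 integrand
`χ′_{X,t} e^{−tṼ(X)}` of the slots located in `X`. [cite: BalabanImbrieJaffe1988, (5.14.2) p.308] -/
theorem prod_filter_slotFactor (t : ℝ) (X : Finset I) (φ : α → ℝ) :
    ∏ τ ∈ univ.filter (fun τ => cube τ ∈ X), slotFactor χ p ek B Φ c Ys V φ τ t =
      (∏ b ∈ slotB B Ys cube X, cutoff χ (c b * pLog p (t * ek)) (Φ b φ)) *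
        Real.exp (-(t * ∑ Y ∈ slotY B Ys cube X, V Y φ)) := by
  rw [prod_filter, Fintype.prod_sum_type, mul_sum, ← sum_neg_distrib, Real.exp_sum, prod_filter, prod_filter]
  congr 1

/-- **`z(X)(Λ)` for the p. 308 cube factors is the restricted interacting integral** `∫ χ′_{X,t} e^{−tṼ(X)} d(law of the fields of X at
1_Λ)` (gen 7/8's family with the slots located in `X`). [cite: BalabanImbrieJaffe1988, (5.14.2) p.308; (5.14.1) p.308] -/
theorem zG_fD_empty_eq_integral (t : ℝ) (X Λ : Finset I) :
    zG blk Δ ℱ (fD (uD χ p ek B Φ c Ys V t) cube γ ∅) X Λ =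
      ∫ ω, (∏ b ∈ slotB B Ys cube X, cutoff χ (c b * pLog p (t * ek)) (Φ b (ext blk X ω))) *
        Real.exp (-(t * ∑ Y ∈ slotY B Ys cube X, V Y (ext blk X ω))) ∂(regionLaw blk Δ ℱ X Λ) := by
  rw [zG_eq_integral_regionLaw]
  simp_rw [obs_fD_empty_eq_prod_filter, prod_filter_slotFactor]

/-- **`z(X)(Λ) = z_t` OF THE p. 308 FAMILY OF THE SLOTS LOCATED IN `X`** under the law of the fields of `X` at `1_Λ` — the object of p36's
(5.14.1)–(5.14.2) theorems (`zt`), for EVERY region and corner of (5.13.4)/(5.14.1) (no "all slots in the region" hypothesis).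
[cite: BalabanImbrieJaffe1988, (5.14.1)–(5.14.2) p.308] -/
theorem zG_fD_empty_eq_ztIn (t : ℝ) (X Λ : Finset I) :
    zG blk Δ ℱ (fD (uD χ p ek B Φ c Ys V t) cube γ ∅) X Λ = ztIn blk Δ ℱ χ p ek B Φ c Ys V cube X Λ t := by
  rw [zG_fD_empty_eq_integral, ztIn, zt_eq]

/-- **`z_t(X)(Λ) > 0`** (`χ(1,·) ≥ 0`, `p ≥ 0`, `Δ ≻ 0`, continuous fields `Φ_b` with `Φ_b(0) = 0` — e.g. the linear functionals of the print —,
`c_b ≥ c₀ > 0`, measurable `|V_Y| ≤ K_Y`, `0 < t`, `te_k ≤ e^{−1}`): the small-field box `{|Φ_b| < (9/10)c₀ : □(b) ⊂ X}` is an open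
neighbourhood of the zero field, charged by the law of the region (p36's `fieldLaw_real_pos_of_isOpen`), and gen 8's
`integral_restrictedInteraction_pos_of_smallBall` applies — p36's `zG_fD_empty_pos` transported to every region and corner.
[cite: BalabanImbrieJaffe1988, (5.14.2) p.308; p.306 (Sect. 5.13)] -/
theorem zG_fD_empty_pos (hχ : ∀ x, 0 ≤ χ.χ₁ x) (hp : 0 ≤ p) (hΔ : Δ.PosDef) (hΦc : ∀ b ∈ B, Continuous (Φ b))
    (hΦ0 : ∀ b ∈ B, Φ b 0 = 0) {c₀ : ℝ} (hc₀ : 0 < c₀) (hcb : ∀ b ∈ B, c₀ ≤ c b) (hV : ∀ Y ∈ Ys, Measurable (V Y))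
    {KY : υ → ℝ} (hK : ∀ Y ∈ Ys, ∀ φ, |V Y φ| ≤ KY Y) (hek : 0 < ek) {t : ℝ} (ht : 0 < t) (h1 : t * ek ≤ Real.exp (-1))
    (X Λ : Finset I) : 0 < zG blk Δ ℱ (fD (uD χ p ek B Φ c Ys V t) cube γ ∅) X Λ := by
  have hPD := prec_interp_corner_posDef blk Δ hΔ X Λ
  haveI := isProbabilityMeasure_regionLaw blk Δ ℱ hΔ X Λ
  have hΦ' : ∀ b ∈ slotB B Ys cube X, Measurable fun ω : {x : α // blk x ∈ X} → ℝ => Φ b (ext blk X ω) := fun b _ =>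
    ((hΦc b b.2).comp (continuous_ext blk X)).measurable
  have hV' : Measurable fun ω : {x : α // blk x ∈ X} → ℝ => ∑ Y ∈ slotY B Ys cube X, V Y (ext blk X ω) :=
    Finset.measurable_sum _ fun Y _ => (hV Y Y.2).comp (measurable_ext blk X)
  have hK' : ∀ ω : {x : α // blk x ∈ X} → ℝ, |∑ Y ∈ slotY B Ys cube X, V Y (ext blk X ω)| ≤ ∑ Y ∈ slotY B Ys cube X, KY Y :=
    fun ω => (abs_sum_le_sum_abs _ _).trans (sum_le_sum fun Y _ => hK Y Y.2 _)
  rw [zG_fD_empty_eq_integral]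
  refine BIJ88ZtPositivity308.integral_restrictedInteraction_pos_of_smallBall χ hχ hp (regionLaw blk Δ ℱ X Λ)
    (slotB B Ys cube X) hΦ' hc₀ (fun b _ => hcb b b.2) hV' hK' hek ?_ ht h1
  have hopen : IsOpen {ω : {x : α // blk x ∈ X} → ℝ | ∀ b ∈ slotB B Ys cube X, |Φ b (ext blk X ω)| < 9 / 10 * c₀} := by
    have hset : {ω : {x : α // blk x ∈ X} → ℝ | ∀ b ∈ slotB B Ys cube X, |Φ b (ext blk X ω)| < 9 / 10 * c₀} =
        ⋂ b ∈ slotB B Ys cube X, {ω | |Φ b (ext blk X ω)| < 9 / 10 * c₀} := by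
      ext ω; simp only [Set.mem_setOf_eq, Set.mem_iInter]
    rw [hset]
    exact isOpen_biInter_finset fun b _ =>
      isOpen_lt (((hΦc b b.2).comp (continuous_ext blk X)).abs) continuous_const
  refine fieldLaw_real_pos_of_isOpen blk _ ℱ X hPD hopen ⟨0, fun b _ => ?_⟩
  show |Φ b (ext blk X 0)| < 9 / 10 * c₀
  rw [ext_zero, hΦ0 b b.2, abs_zero]
  positivity

end CubeFactors

/-! ## §4 (5.14.5) on the model with the p. 308 cube factors: `z`, `z_F/z` concrete, `z > 0` discharged -/

section Knit

variable (adj : I → I → Prop) [DecidableRel adj]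
variable (χ : CutoffProfile) {ι υ : Type*} [DecidableEq ι] [DecidableEq υ]
variable {p ek : ℝ} {B : Finset ι} {Φ : ι → (α → ℝ) → ℝ} {c : ι → ℝ} {Ys : Finset υ} {V : υ → (α → ℝ) → ℝ}
variable (cube : ↥B ⊕ ↥Ys → I) {L : Type*} (γ : L → ↥B ⊕ ↥Ys)

/-- **(5.14.5) ON THE §5.13 GAUSSIAN MODEL WITH THE p. 308 CUBE FACTORS** `f(□_i) = u_i · F_i`, `u = fD (uD χ p e_k B Φ c Ys V 1) cube γ ∅`
(small-field characteristic functions and Boltzmann factors of the slots of `□_i` at `t = 1`), `F_i` cube-local observables: with `Δ`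
coupling abutting cubes only and `≻ 0`, `χ ≥ 0`, `p ≥ 0`, continuous cube-local `Φ_b` vanishing at `0`, `c_b ≥ c₀ > 0`, measurable bounded
cube-local `V_Y`, `0 < e_k ≤ e^{−1}`:
`e^{−V_const}·⟨Π_{i∈W} u_i F_i⟩_{1,W} = Σ_{ρ admissible outer} (Π_{X∈ρ} g₁ X) · (z_F/z)(Λ₁₂)(Λ₁₂′) · exp(−𝒫^L − Σ_X (W₆′ + W₆″))`,
where `z = ⟨Π u⟩`, `z_F = ⟨Π uF⟩` are the CONCRETE corner expectations (`z > 0` PROVED, *"z_F = (z_F/z)·z"* by definition, `z_F/z = ⟨Π F⟩₁` by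
`zG_div_zG_eq_ratio`), and per region ONLY `hlogz` (−log z(Λ₁₂)(Λ₁₂′) = pert + rem: (5.14.2) at `t = 0`), `hrem` (p. 310 `ℛ = Σ W₆′`), `h311`
(p. 311) are displayed. [cite: BalabanImbrieJaffe1988, (5.14.5) p.312; (5.14.1)–(5.14.2) p.308] -/
theorem eq5145_zG (hΔadj : ∀ x y, blk x ≠ blk y → ¬ adj (blk x) (blk y) → Δ x y = 0) (hΔ : Δ.PosDef)
    (hχ : ∀ x, 0 ≤ χ.χ₁ x) (hp : 0 ≤ p) (hΦc : ∀ b ∈ B, Continuous (Φ b)) (hΦ0 : ∀ b ∈ B, Φ b 0 = 0) {c₀ : ℝ} (hc₀ : 0 < c₀)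
    (hcb : ∀ b ∈ B, c₀ ≤ c b) (hV : ∀ Y ∈ Ys, Measurable (V Y)) {KY : υ → ℝ} (hK : ∀ Y ∈ Ys, ∀ φ, |V Y φ| ≤ KY Y)
    (hek : 0 < ek) (hek1 : ek ≤ Real.exp (-1))
    (hΦloc : ∀ b : B, ∀ φ ψ : α → ℝ, (∀ x, blk x = cube (Sum.inl b) → φ x = ψ x) → Φ b φ = Φ b ψ)
    (hVloc : ∀ Y : Ys, ∀ φ ψ : α → ℝ, (∀ x, blk x = cube (Sum.inr Y) → φ x = ψ x) → V Y φ = V Y ψ)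
    (F : I → (α → ℝ) → ℝ) (hFloc : ∀ i (φ ψ : α → ℝ), (∀ x, blk x = i → φ x = ψ x) → F i φ = F i ψ)
    (W Bl : Finset I) {Xt : Type*} (𝒳 : Finset Xt) (Vconst PL : ℝ) (pert rem : Finset (Finset I) → ℝ)
    (W6p W6pp : Finset (Finset I) → Xt → ℝ)
    (hlogz : ∀ ρ ∈ (outer W Bl).filter (IsAdmissible adj),
      -Real.log (zG blk Δ ℱ (fD (uD χ p ek B Φ c Ys V 1) cube γ ∅) (lam12 W ρ) (lam12' adj W ρ)) = pert ρ + rem ρ)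
    (hrem : ∀ ρ ∈ (outer W Bl).filter (IsAdmissible adj), rem ρ = ∑ X ∈ 𝒳, W6p ρ X)
    (h311 : ∀ ρ ∈ (outer W Bl).filter (IsAdmissible adj), Vconst + pert ρ = PL + ∑ X ∈ 𝒳, W6pp ρ X) :
    Real.exp (-Vconst) * expect blk Δ ℱ (fun i φ => fD (uD χ p ek B Φ c Ys V 1) cube γ ∅ i φ * F i φ) W (corner ℝ W) =
      ∑ ρ ∈ (outer W Bl).filter (IsAdmissible adj),
        (∏ X ∈ ρ, g1 adj (zG blk Δ ℱ (fun i φ => fD (uD χ p ek B Φ c Ys V 1) cube γ ∅ i φ * F i φ)) X) *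
          (zG blk Δ ℱ (fun i φ => fD (uD χ p ek B Φ c Ys V 1) cube γ ∅ i φ * F i φ) (lam12 W ρ) (lam12' adj W ρ) /
              zG blk Δ ℱ (fD (uD χ p ek B Φ c Ys V 1) cube γ ∅) (lam12 W ρ) (lam12' adj W ρ) *
            Real.exp (-PL - ∑ X ∈ 𝒳, (W6p ρ X + W6pp ρ X))) := by
  have hf : ∀ i (φ ψ : α → ℝ), (∀ x, blk x = i → φ x = ψ x) →
      fD (uD χ p ek B Φ c Ys V 1) cube γ ∅ i φ * F i φ = fD (uD χ p ek B Φ c Ys V 1) cube γ ∅ i ψ * F i ψ :=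
    fun i φ ψ h => by rw [fD_local blk γ (uD_local blk χ cube hΦloc hVloc 1) ∅ i φ ψ h, hFloc i φ ψ h]
  have hpos : ∀ ρ : Finset (Finset I), 0 < zG blk Δ ℱ (fD (uD χ p ek B Φ c Ys V 1) cube γ ∅) (lam12 W ρ) (lam12' adj W ρ) :=
    fun ρ => zG_fD_empty_pos blk Δ ℱ χ p ek B Φ c Ys V cube γ hχ hp hΔ hΦc hΦ0 hc₀ hcb hV hK hek one_pos
      (by rwa [one_mul]) _ _
  exact eq5145_corner_gauss blk Δ ℱ _ adj hΔadj hf W Bl 𝒳 Vconst PL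
    (fun ρ => zG blk Δ ℱ (fD (uD χ p ek B Φ c Ys V 1) cube γ ∅) (lam12 W ρ) (lam12' adj W ρ))
    (fun ρ => zG blk Δ ℱ (fun i φ => fD (uD χ p ek B Φ c Ys V 1) cube γ ∅ i φ * F i φ) (lam12 W ρ) (lam12' adj W ρ) /
      zG blk Δ ℱ (fD (uD χ p ek B Φ c Ys V 1) cube γ ∅) (lam12 W ρ) (lam12' adj W ρ))
    pert rem W6p W6pp (fun ρ _ => hpos ρ) (fun ρ _ => (div_mul_cancel₀ _ (hpos ρ).ne').symm)
    (fun ρ hρ => by linarith [hlogz ρ hρ]) hrem h311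

variable {S : Type*} {K : Type*} [AddCommGroup K] [Module ℝ K]
variable {D : Type*} [Fintype D] {P : Type*} [DecidableEq P]
variable (m : D → ℕ) (spec : (δ : D) → Fin (m δ) → S) (T : (δ : D) → I → MultilinearMap ℝ (fun _ : Fin (m δ) => K) ℝ)
variable (Cstd : S → K) (pc : Finset I → S → Finset P) (E : Finset I → S → P → K) (reg : P → Finset I) (ord : D → ℕ) (nbar : ℕ)

/-- **… WITH `h311` BY NAME** (p31's `extraction311`: `𝒫^L := PL`, `W₆″ := W6pp`, `𝒳 := A.powerset`, region-dependent propagator pieces inside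
`A ⊇ W`); displayed per region: `hlogz` with `pert := p31's pert` and `hrem`. [cite: BalabanImbrieJaffe1988, (5.14.5) p.312; p.311] -/
theorem eq5145_zG_extraction (hΔadj : ∀ x y, blk x ≠ blk y → ¬ adj (blk x) (blk y) → Δ x y = 0) (hΔ : Δ.PosDef)
    (hχ : ∀ x, 0 ≤ χ.χ₁ x) (hp : 0 ≤ p) (hΦc : ∀ b ∈ B, Continuous (Φ b)) (hΦ0 : ∀ b ∈ B, Φ b 0 = 0) {c₀ : ℝ} (hc₀ : 0 < c₀)
    (hcb : ∀ b ∈ B, c₀ ≤ c b) (hV : ∀ Y ∈ Ys, Measurable (V Y)) {KY : υ → ℝ} (hK : ∀ Y ∈ Ys, ∀ φ, |V Y φ| ≤ KY Y)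
    (hek : 0 < ek) (hek1 : ek ≤ Real.exp (-1))
    (hΦloc : ∀ b : B, ∀ φ ψ : α → ℝ, (∀ x, blk x = cube (Sum.inl b) → φ x = ψ x) → Φ b φ = Φ b ψ)
    (hVloc : ∀ Y : Ys, ∀ φ ψ : α → ℝ, (∀ x, blk x = cube (Sum.inr Y) → φ x = ψ x) → V Y φ = V Y ψ)
    (F : I → (α → ℝ) → ℝ) (hFloc : ∀ i (φ ψ : α → ℝ), (∀ x, blk x = i → φ x = ψ x) → F i φ = F i ψ)
    (W Bl : Finset I) (Vconst : ℝ) (A : Finset I) (hWA : W ⊆ A) (hreg : ∀ W' s, ∀ r ∈ pc W' s, reg r ⊆ A)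
    (rem : Finset (Finset I) → ℝ) (W6p : Finset (Finset I) → Finset I → ℝ)
    (hlogz : ∀ ρ ∈ (outer W Bl).filter (IsAdmissible adj),
      -Real.log (zG blk Δ ℱ (fD (uD χ p ek B Φ c Ys V 1) cube γ ∅) (lam12 W ρ) (lam12' adj W ρ)) =
        pert m spec T Cstd (pc (lam12 W ρ)) (E (lam12 W ρ)) (lam12 W ρ) + rem ρ)
    (hrem : ∀ ρ ∈ (outer W Bl).filter (IsAdmissible adj), rem ρ = ∑ X ∈ A.powerset, W6p ρ X) :
    Real.exp (-Vconst) * expect blk Δ ℱ (fun i φ => fD (uD χ p ek B Φ c Ys V 1) cube γ ∅ i φ * F i φ) W (corner ℝ W) =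
      ∑ ρ ∈ (outer W Bl).filter (IsAdmissible adj),
        (∏ X ∈ ρ, g1 adj (zG blk Δ ℱ (fun i φ => fD (uD χ p ek B Φ c Ys V 1) cube γ ∅ i φ * F i φ)) X) *
          (zG blk Δ ℱ (fun i φ => fD (uD χ p ek B Φ c Ys V 1) cube γ ∅ i φ * F i φ) (lam12 W ρ) (lam12' adj W ρ) /
              zG blk Δ ℱ (fD (uD χ p ek B Φ c Ys V 1) cube γ ∅) (lam12 W ρ) (lam12' adj W ρ) *
            Real.exp (-PL m spec T Cstd ord nbar Vconst A - ∑ X ∈ A.powerset, (W6p ρ X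
              + W6pp m spec T Cstd (pc (lam12 W ρ)) (E (lam12 W ρ)) reg ord nbar A (lam12 W ρ) X))) :=
  eq5145_zG blk Δ ℱ adj χ cube γ hΔadj hΔ hχ hp hΦc hΦ0 hc₀ hcb hV hK hek hek1 hΦloc hVloc F hFloc W Bl A.powerset Vconst
    (PL m spec T Cstd ord nbar Vconst A) (fun ρ => pert m spec T Cstd (pc (lam12 W ρ)) (E (lam12 W ρ)) (lam12 W ρ)) rem W6p
    (fun ρ X => W6pp m spec T Cstd (pc (lam12 W ρ)) (E (lam12 W ρ)) reg ord nbar A (lam12 W ρ) X) hlogz hrem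
    fun ρ _ => extraction311 m spec T Cstd (pc (lam12 W ρ)) (E (lam12 W ρ)) reg ord nbar Vconst ((lam12_subset W ρ).trans hWA) (hreg _)

end Knit

end Literature.MathematicalPhysics.QuantumFieldTheory.BalabanImbrieJaffe1984to88.BIJ88Eq5145CornerModel

end
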